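import Summits.KontsevichZagierPeriods.KontsevichZagierPeriods.Theses.DessinsDimensionOne
import Literature.NumberTheory.Transcendental.KZRelationsLE
import Literature.NumberTheory.Transcendental.KZRulesAssociator
import Literature.NumberTheory.Transcendental.KZLogCalculusProofs
import Summits.KontsevichZagierPeriods.KontsevichZagierPeriods.Theorems.AbelContractionAbelContractionLemma
import Summits.KontsevichZagierPeriods.KontsevichZagierPeriods.Theorems.ReducedPeriodRing.Negative.DimZero
import Summits.KontsevichZagierPeriods.KontsevichZagierPeriods.Theorems.LowDimensionLowdimDimZero

/-!
# `ExcursionBudgetDimZero` (stmt-KontsevichZagierPeriods-14369) — Conjecture 1 in dimension `0`, budget `≤ 1`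

Closing file for the dimension-`0` layer of the excursion-budget form of Kontsevich–Zagier's
Conjecture 1 (route DessinsDimensionOne, item 14369): two `0`-dimensional integral
representations with the same value differ by an element of the TRUNCATED relations
`KZ.relationsLE 1` — in fact every move used lives among representations of dimension `0`.
No transcendence input: `Set (Fin 0 → ℝ) = {∅, univ}`, the value of `[pt, f]` is `f pt`
(`vol ℝ⁰ = 1`, REUSED tree lemma `ReducedPeriodRingNegative.value_eq_integrand_default`) and the
value over `∅` is `0` (REUSED tree lemma `LowdimDimZero.domain_eq_univ_of_value_ne_zero`). If the
common value is `0`, both integrands vanish on their domains, so both representations are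
truncated relations by rule (1b) inside dimension `0`
(REUSED `AbelContractionLemma.of_mem_relationsLE_of_eqOn_zero`); otherwise both domains are the
point and the integrands agree there, so the two representations are congruent inside dimension
`0` (rule (1b) with a zero representation, REUSED `AbelContractionLemma.mem_relationsLE_of_integrandAdd`).
Prepared by the lead seat c5 of crux stmt-KontsevichZagierPeriods-3869 (line SketchIdeator1).

Sources: M. Kontsevich, D. Zagier, *Periods* (2001), §1.1 (ℝ⁰ is a point of volume 1), §1.2 rule (1),
Conjecture 1; the truncation `KZ.relationsLE` of `Literature/NumberTheory/Transcendental/KZRelationsLE.lean`.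
No definitions are introduced.
-/

noncomputable section

open MeasureTheory Set
open Literature.NumberTheory.Transcendental Literature.NumberTheory.Transcendental.KZ
open Summit.KontsevichZagierPeriods.AbelContraction.AbelContractionLemma
  (mem_relationsLE_of_integrandAdd of_mem_relationsLE_of_eqOn_zero)
open Summit.KontsevichZagierPeriods.KontsevichZagierPeriods.ReducedPeriodRingNegative
  (value_eq_integrand_default)
open Summit.KontsevichZagierPeriods.LowDimension.LowdimDimZero (domain_eq_univ_of_value_ne_zero)

namespace Summit.KontsevichZagierPeriods.DessinsDimensionOne.ExcursionBudgetDimZero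

/-- **Congruence inside dimension `≤ d`**: two representations of dimension `k ≤ d` with the same
domain whose integrands agree ON the domain differ by a truncated relation (rule (1b) with the zero
representation on the domain; the `relations`-version is `KZ.of_sub_of_mem_relations_of_eqOn`).
[cite: KontsevichZagier2001, §1.2 rule (1)] -/
theorem of_sub_of_mem_relationsLE_of_eqOn {k d : ℕ} (hk : k ≤ d) {r r' : IntegralRep k}
    (hd : r'.domain = r.domain) (h : EqOn r.integrand r'.integrand r.domain) :
    of r - of r' ∈ relationsLE d := by
  obtain ⟨z, hzd, hzi⟩ := exists_zeroRep r.isSemialgebraic_domain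
  have h1 : of r - of r' - of z ∈ relationsLE d :=
    mem_relationsLE_of_integrandAdd hk hd hzd fun x hx => by simp [hzi, h hx]
  have h2 : of z ∈ relationsLE d := of_mem_relationsLE_of_eqOn_zero hk z (by simp [hzi, EqOn])
  have e : of r - of r' = (of r - of r' - of z) + of z := by abel
  rw [e]
  exact (relationsLE d).add_mem h1 h2

/-- **A constant of value `0` is a truncated relation in every dimension budget**: the integrand of
a `0`-dimensional representation of value `0` vanishes on its domain (empty, or the point, where the
value is the integrand), so rule (1b) inside dimension `0 ≤ d` applies (the `relations`-version is
`BetaCancellationLine.of_mem_relations_of_dim_zero_of_value_eq_zero`).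
[cite: KontsevichZagier2001, §1.2 rule (1)] -/
theorem of_mem_relationsLE_of_dim_zero_of_value_eq_zero {d : ℕ} (r : IntegralRep 0)
    (h : r.value = 0) : of r ∈ relationsLE d := by
  refine of_mem_relationsLE_of_eqOn_zero (Nat.zero_le d) r fun x hx => ?_
  have hdom : r.domain = univ := Subsingleton.eq_univ_of_nonempty ⟨x, hx⟩
  rw [Pi.zero_apply, Subsingleton.elim x default, ← value_eq_integrand_default r hdom, h]

/-- **Kontsevich–Zagier's Conjecture 1 in dimension `0` with excursion budget `≤ 1`** (item
stmt-KontsevichZagierPeriods-14369, the layer `d = 0` of `ExcursionBudget`): two `0`-dimensional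
integral representations with equal values differ by an element of `KZ.relationsLE 1`.
[cite: KontsevichZagier2001, §1.2 Conjecture 1] -/
theorem excursionBudgetDimZero_proof :
    Summit.KontsevichZagierPeriods.KontsevichZagierPeriods.Theses.DessinsDimensionOne.ExcursionBudgetDimZero := by
  intro r r' hv
  show of r - of r' ∈ relationsLE 1
  by_cases h0 : r.value = 0
  · exact (relationsLE 1).sub_mem (of_mem_relationsLE_of_dim_zero_of_value_eq_zero r h0)
      (of_mem_relationsLE_of_dim_zero_of_value_eq_zero r' (hv ▸ h0))
  have hd : r.domain = univ := domain_eq_univ_of_value_ne_zero r h0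
  have hd' : r'.domain = univ := domain_eq_univ_of_value_ne_zero r' fun h => h0 (hv.trans h)
  refine of_sub_of_mem_relationsLE_of_eqOn zero_le_one (hd'.trans hd.symm) fun x _ => ?_
  rw [Subsingleton.elim x default, ← value_eq_integrand_default r hd,
    ← value_eq_integrand_default r' hd', hv]

end Summit.KontsevichZagierPeriods.DessinsDimensionOne.ExcursionBudgetDimZero

end
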